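import Summits.Ventures.YMGap.RobustBall.AxialPairWitness
import Summits.Ventures.YMGap.RobustBall.RowsSN
import HarnessLib

/-!
# Venture YMGap, track ROBUST-BALL (tier 2) — certified `SU(2)` rows on `ℤ⁴` containing the
# infinite-range axial-pair member

HONEST FRAMING. WHAT THIS IS: a venture file (cell `pub-ymgap`, track Y2 ROBUST-BALL, seat rb-p1): two
NAMED ROWS for the infinite-range member `axialPairWitness 2 τ (1/10)` of `AxialPairWitness.lean`, read
off the certified tier-2 table `RowsS.lean` by bounding its explicit loads: `SU(2)` on `ℤ⁴` at Wilson
coupling `β_W = 1/16` plus ALL axial plaquette-pair couplings `τ (1/10)^{dist} (Re tr U_p/2)(Re tr U_q/2)`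
with `|τ| ≤ 1/320` has exactly one DLR state, exponentially clustering at rate `log (3/2)` per lattice
unit (`su2_axialPair_massGapS_1_16`, inside row `su2_rowS32_1_16`); at `β_W = 1/20`, `|τ| ≤ 1/600` the
same at rate `log 2` (`su2_axialPair_massGapS_1_20`, inside row `su2_rowS2_1_20`); and for ALL `N ≥ 2` at
`SU(N)` coupling `β = 1/64`, `|τ| ≤ 1/420`: one DLR state clustering at rate `log (6/5)`
(`suN_axialPair_massGapS_1_64`, inside the hypothesis-free all-`N` row `suN_rowS_1_64` of `RowsSN.lean`).
Exact rational arithmetic plus `√N ≥ √2 ≥ 1.41421`. WHAT IT IS NOT: a strong-coupling lattice statement; no claim about the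
continuum limit, asymptotic scaling, or the Clay Millennium problem.

References: rows of `RowsS.lean` (this track; lineage-R re-certified, rb-ref RB-42).
-/

noncomputable section

open MeasureTheory Filter Function Topology Real Finset
open Literature.Probability.LatticeModels
open Literature.Probability.LatticeModels.DobrushinMetric
open Literature.MathematicalPhysics.QuantumLattice
open Literature.MathematicalPhysics.QuantumFieldTheory hiding ZdEdge

namespace Summit.Ventures.YMGap.RobustBall

variable {d N : ℕ}

/-! ### Certified `SU(2)` rows on `ℤ⁴` containing the witness -/

section Rows

/-- **Row (infinite-range member, rate `log (3/2)`)**: `SU(2)` on `ℤ⁴` at Wilson coupling `β_W = 1/16`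
plus ALL axial plaquette-pair couplings `τ (1/10)^{dist} (Re tr U_p/2)(Re tr U_q/2)` with `|τ| ≤ 1/320`
has exactly one DLR state, exponentially clustering at rate `log (3/2)` per lattice unit — the member lies
in the ball of row `su2_rowS32_1_16` (loads `a ≤ 1/30 ≤ 0.372`, `Λ_{log 3/2} ≤ 0.18302 ≤ 0.186`). -/
theorem su2_axialPair_massGapS_1_16 {τ : ℝ} (hτ : |τ| ≤ 1 / 320) :
    PerturbedMassGapAtS 4 2 ((1 / 16 : ℝ) / 4) (axialPairWitness (d := 4) 2 τ (1 / 10)) := by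
  have hq : exp (Real.log (3 / 2)) = 3 / 2 := Real.exp_log (by norm_num)
  have hmem := memBallZdS_axialPairWitness (d := 4) (N := 2) (τ := τ) (κ := 1 / 10) (t := Real.log (3 / 2))
    (by norm_num) (by norm_num) (by norm_num) (by norm_num) (Real.log_nonneg (by norm_num)) (by rw [hq]; norm_num)
  rw [hq] at hmem
  have hs := sqrt_two_ge
  have hs0 : (0 : ℝ) < Real.sqrt 2 := by linarith
  have hτ0 : 0 ≤ |τ| := abs_nonneg τ
  have hdiv : |τ| / Real.sqrt 2 ≤ (1 / 320) / (141421 / 100000) := div_le_div₀ (by norm_num) hτ (by norm_num) hs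
  refine su2_rowS32_1_16 _ (hmem.mono ?_ ?_)
  · push_cast; nlinarith
  · push_cast
    nlinarith [hdiv, div_nonneg hτ0 hs0.le]

/-- **Row (infinite-range member, rate `log 2`)**: `SU(2)` on `ℤ⁴` at `β_W = 1/20` plus all axial
plaquette-pair couplings `τ (1/10)^{dist} (Re tr U_p/2)(Re tr U_q/2)` with `|τ| ≤ 1/600`: exactly one DLR
state, clustering at rate `log 2` — the member lies in the ball of row `su2_rowS2_1_20`
(loads `a ≤ 0.0178 ≤ 0.334`, `Λ_{log 2} ≤ 0.1635 ≤ 0.167`). -/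
theorem su2_axialPair_massGapS_1_20 {τ : ℝ} (hτ : |τ| ≤ 1 / 600) :
    PerturbedMassGapAtS 4 2 ((1 / 20 : ℝ) / 4) (axialPairWitness (d := 4) 2 τ (1 / 10)) := by
  have hq : exp (Real.log 2) = 2 := Real.exp_log (by norm_num)
  have hmem := memBallZdS_axialPairWitness (d := 4) (N := 2) (τ := τ) (κ := 1 / 10) (t := Real.log 2)
    (by norm_num) (by norm_num) (by norm_num) (by norm_num) (Real.log_nonneg (by norm_num)) (by rw [hq]; norm_num)
  rw [hq] at hmem
  have hs := sqrt_two_ge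
  have hs0 : (0 : ℝ) < Real.sqrt 2 := by linarith
  have hτ0 : 0 ≤ |τ| := abs_nonneg τ
  have hdiv : |τ| / Real.sqrt 2 ≤ (1 / 600) / (141421 / 100000) := div_le_div₀ (by norm_num) hτ (by norm_num) hs
  refine su2_rowS2_1_20 _ (hmem.mono ?_ ?_)
  · push_cast; nlinarith
  · push_cast
    nlinarith [hdiv, div_nonneg hτ0 hs0.le]

/-- **Row (infinite-range member, ALL `N ≥ 2`, rate `log (6/5)`)**: `SU(N)` on `ℤ⁴` at coupling `β = 1/64`
(`N β` multiplies `Re tr U_p`) plus all axial plaquette-pair couplings `τ (1/10)^{dist} (Re tr U_p/N)(Re tr U_q/N)`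
with `|τ| ≤ 1/420`: exactly one DLR state, clustering at rate `log (6/5)` — the member lies in the ball of the
hypothesis-free all-`N` row `suN_rowS_1_64` (loads `a ≤ 0.0254 ≤ 1/20`, `Λ_{log 6/5} ≤ 0.096 ≤ 1/10`, using
`√N ≥ √2`). -/
theorem suN_axialPair_massGapS_1_64 {N : ℕ} (hN : 2 ≤ N) {τ : ℝ} (hτ : |τ| ≤ 1 / 420) :
    PerturbedMassGapAtS 4 N (1 / 64 : ℝ) (axialPairWitness (d := 4) N τ (1 / 10)) := by
  have hq : exp (Real.log (6 / 5)) = 6 / 5 := Real.exp_log (by norm_num)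
  have hmem := memBallZdS_axialPairWitness (d := 4) (N := N) (τ := τ) (κ := 1 / 10) (t := Real.log (6 / 5))
    (by norm_num) (by omega) (by norm_num) (by norm_num) (Real.log_nonneg (by norm_num)) (by rw [hq]; norm_num)
  rw [hq] at hmem
  have hN2 : (2 : ℝ) ≤ N := by exact_mod_cast hN
  have hs : (141421 / 100000 : ℝ) ≤ Real.sqrt N := sqrt_two_ge.trans (Real.sqrt_le_sqrt hN2)
  have hs0 : (0 : ℝ) < Real.sqrt N := by linarith
  have hτ0 : 0 ≤ |τ| := abs_nonneg τ
  have hdiv : |τ| / Real.sqrt N ≤ (1 / 420) / (141421 / 100000) := div_le_div₀ (by norm_num) hτ (by norm_num) hs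
  refine suN_rowS_1_64 hN _ (hmem.mono ?_ ?_)
  · push_cast; nlinarith
  · push_cast
    nlinarith [hdiv, div_nonneg hτ0 hs0.le]

end Rows

end Summit.Ventures.YMGap.RobustBall
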